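import Summits.QuantumFields.Balaban3D.Proofs.FibreZeroSU2Regular
import Summits.QuantumFields.Balaban3D.Proofs.StarCountFree
import Summits.QuantumFields.Balaban3D.Proofs.Inputs

/-!
# `Summit.QuantumFields.Balaban3D.Proofs.FibreZeroLane` — THE END THEOREM'S TWO RESIDUAL ROWS AT THE FIRST STEP, FOR THE LANE'S OWN STEP PIECES:
# R3D-01 `Fibre49 … 0 (piecesW 𝔎 X 𝔖 0) triv` and R3D-02 `Fibre57Low … 0 (piecesW 𝔎 X 𝔖 0)` (the `k = 0` instances of the residual
# hypotheses `hfibre`/`hfibreLow` of `…Proofs.AlphaBound55` / `…Proofs.UVStability3DInputs`, G = SU(2)), from `…FibreZeroSU2Regular.fibre_pair_zero`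
# with TWO of its six data pins DISCHARGED for the lane's pieces `Inputs.piecesW` — `hstar` (|T₁*| = #free bonds, `…StarCountFree`) and `hPold`
# ((43)/(58): «Σ_{j=1}^{k}» is empty at k = 0, `Carriers.seriesPieces_Pold`) — the remaining four being VALUES of the family constants (`log σ₀`,
# `d(𝔤) = 3`) and of the SeriesData-defined pieces (`log Z^{(0)}`, `log Fl`) at the trivial history (seat p4, lane `pub-balaban3d`; FIBRE49 (S4)).

HONEST FRAMING (lane PLAN.md §0, binding): see `…Proofs.SectAFirstStep`.  [folklore] assembly BY NAME of `…FibreZeroSU2Regular.fibre_pair_zero`,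
`…StarCountFree.starB_triv_piecesParamsOf`, `Carriers.seriesPieces_Pold`; the b11 regularity row `hmin` ([7] Thm 1), the b9 datum `q` and print's (12)
for `U₁ = X.Uk 0` stay hypotheses; nothing of the paper is asserted.  Not in the END import cone (it imports the cone, not conversely).
-/

noncomputable section

namespace Summit.QuantumFields.Balaban3D.Proofs.FibreZeroLane

open _root_.MeasureTheory
open Literature.MathematicalPhysics.QuantumFieldTheory.Balaban1983to89
open Literature.MathematicalPhysics.QuantumFieldTheory.Balaban1983to89.AveragingRT (axialAvg)
open Literature.MathematicalPhysics.QuantumFieldTheory.Balaban1983to89.B10SectAGathering (StepPieces)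
open Literature.MathematicalPhysics.QuantumFieldTheory.Balaban1985CMP102
open Literature.MathematicalPhysics.QuantumFieldTheory.Balaban1985CMP102.Setting
open Summit.QuantumFields.Balaban3D.Carriers
open Summit.QuantumFields.Balaban3D.Proofs.Bound55Std (Fibre49 Fibre57Low)
open Summit.QuantumFields.Balaban3D.Proofs.ProductChartSU2 (SU2)
open Summit.QuantumFields.Balaban3D.Proofs.AxialGaugeFix (forest)
open Summit.QuantumFields.Balaban3D.Proofs.FluctGaussSU2 (Free sigma0 fluctIntegrand)
open Summit.QuantumFields.Balaban3D.Proofs.ChartScalingSU2 (E3)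
open Summit.QuantumFields.Balaban3D.Proofs.GaussianNormalization (partZ normalized)
open Summit.QuantumFields.Balaban3D.Proofs.FibreZeroSU2 (act0)
open Summit.QuantumFields.Balaban3D.Proofs.Inputs (LaneConsts piecesW)

variable {L : ℕ} (𝔎 : LaneConsts L) {S : Scales L} {G : Type} [GaugeGroup G] [MeasurableSpace G] [HaarData G]
  {V : Type} [NormedAddCommGroup V] [NormedSpace ℂ V]
  (X : ExternalInputs S G) (𝔖 : ∀ k, StepSeries S G V (nblkOf S 𝔎.carrier k) k)

/-! ## §1 Two pins of `fibre_pair_zero` hold for the lane's pieces -/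

/-- **`hstar` FOR THE LANE'S PIECES**: `starB(triv) = |T₁^{(0)*| = #Free` at the first step (`…StarCountFree.starB_triv_piecesParamsOf`; `piecesW`'s
`starB` is `(piecesParamsOf S 𝔎.carrier 0).starB` by construction). [cite: Balaban1985UV3, p.260 (after (18)) + (55) p.269] -/
theorem piecesW_starB_triv [DecidableEq (PBond S.P 0)] (hj : 1 ≤ S.P.m + S.P.K) :
    (piecesW 𝔎 X 𝔖 0).starB (Hist.triv S.P 1) = (Fintype.card (Free S.P 0) : ℝ) :=
  StarCountFree.starB_triv_piecesParamsOf S 𝔎.carrier hj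

/-- **`hPold` FOR THE LANE'S PIECES**: the old-term sum «Σ_{j=1}^{k} Σ_{Y_j} 𝒫_j(Y_j, U_{k+1})» of (43)/(58) is EMPTY at `k = 0`
(`Carriers.seriesPieces_Pold`: the outer index set `Icc 1 0 = ∅`). [cite: Balaban1985UV3, (43) p.266 + (58) p.270] -/
theorem piecesW_Pold_zero (h : Hist S.P 1) (U : GaugeField S.P 1 G) : (piecesW 𝔎 X 𝔖 0).Pold h U = 0 := by
  show (seriesPieces (X.toTowerBase 𝔎.carrier) 𝔖 (piecesParamsOf S 𝔎.carrier) 0).Pold h U = 0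
  rw [seriesPieces_Pold]
  simp

/-- `piecesW`'s `log σ₀` is the family constant. [folklore] -/
theorem piecesW_logσ₀ (k : ℕ) : (piecesW 𝔎 X 𝔖 k).logσ₀ = 𝔎.F.logσ₀ := rfl

/-- `piecesW`'s `d(𝔤)` is the family constant `dimg`. [folklore] -/
theorem piecesW_dg (k : ℕ) : (piecesW 𝔎 X 𝔖 k).dg = 𝔎.F.dimg := rfl

/-! ## §2 The residual rows of the END theorem at `k = 0`, `G = SU(2)` -/

/-- **R3D-01(triv) ∧ R3D-02 AT `k = 0` FOR THE LANE'S END PIECES `piecesW 𝔎 X 𝔖 0`, `G = SU(2)`** — the `k = 0` instances of the residual rows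
`hfibre (h′ := triv)` / `hfibreLow` consumed by `…Proofs.AlphaBound55` — from: the standing range; the lane's axial averaging at level 0; print's (12)
for the background `U₁ = X.Uk 0` (`hax`: `U₁ = 1` on the radial forest, `hfib`: `Ū₁ = V`); the b11 REGULARITY ROW `hmin` ([7] Thm 1 / p. 265 L24–26
«χ₁ denotes restrictions on V of the form |U₁(∂p) − 1| < L⁻²g₀p(g₁), where U₁ = U₁(V) is the minimal configuration determined by V»); a measurable
quadratic datum `q_V` with `Z(V) > 0` (b9); the family constants carrying print's values `log σ₀ = log σ(0)` and `d(𝔤) = 3`; and the series' pieces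
`log Z^{(0)}(triv, ·)`, `log Fl(triv, ·)` carrying the (22) values.  The pins `hstar` and `hPold` of `…FibreZeroSU2Regular.fibre_pair_zero` are
DISCHARGED (§1). [cite: Balaban1985UV3, (12)–(22) pp.258–261 + p.265 L24–29] -/
theorem fibre_pair_zero_piecesW [DecidableEq (PBond S.P 0)] (X : ExternalInputs S SU2)
    (𝔖 : ∀ k, StepSeries S SU2 V (nblkOf S 𝔎.carrier k) k) (hj : 1 ≤ S.P.m + S.P.K)
    (hav : (X.av 0).avg = axialAvg) (hax : ∀ W, ∀ b ∈ forest S.P 0, X.Uk 0 W b = 1) (hfib : ∀ W, axialAvg (X.Uk 0 W) = W)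
    (hmin : ∀ W, PlaqSmall (eps1Of S 𝔎.carrier 1) W → PlaqSmall (eps1Of S 𝔎.carrier 0) (X.Uk 0 W))
    (q : GaugeField S.P 1 SU2 → (Free S.P 0 → E3) → ℝ) (hqm : ∀ W, Measurable (q W))
    (hZ : ∀ W, 0 < partZ (volume : Measure (Free S.P 0 → E3)) (q W))
    (hσ : 𝔎.F.logσ₀ = Real.log sigma0) (hdg : 𝔎.F.dimg = 3)
    (hZU : ∀ W, (piecesW 𝔎 X 𝔖 0).logZU (Hist.triv S.P 1) W = Real.log (partZ (volume : Measure (Free S.P 0 → E3)) (q W)))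
    (hFl : ∀ W, (piecesW 𝔎 X 𝔖 0).logFl (Hist.triv S.P 1) W =
      Real.log (∫ A, fluctIntegrand (act0 S) (chiSmall Set.univ (eps1Of S 𝔎.carrier 0)) q (X.Uk 0) (S.gk 0) W A
        ∂(normalized (volume : Measure (Free S.P 0 → E3)) (q W)))) :
    Fibre49 X 𝔎.carrier 𝔖 (fun _ => True) 0 (piecesW 𝔎 X 𝔖 0) (Hist.triv S.P 1)
      ∧ Fibre57Low X 𝔎.carrier 𝔖 (fun _ => True) 0 (piecesW 𝔎 X 𝔖 0) :=
  FibreZeroSU2Regular.fibre_pair_zero X 𝔎.carrier 𝔖 (fun _ => True) hj (piecesW 𝔎 X 𝔖 0) hav hax hfib hmin q hqm hZ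
    ((piecesW_logσ₀ 𝔎 X 𝔖 0).trans hσ) ((piecesW_dg 𝔎 X 𝔖 0).trans (by rw [hdg]; norm_num))
    (piecesW_starB_triv 𝔎 X 𝔖 hj) (piecesW_Pold_zero 𝔎 X 𝔖 (Hist.triv S.P 1)) hZU hFl

end Summit.QuantumFields.Balaban3D.Proofs.FibreZeroLane

end
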